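import Summits.BirchSwinnertonDyer.BirchSwinnertonDyer.Theorems.EisensteinPrimesPoitouTateReciprocityS
import Literature.NumberTheory.GaloisCohomology.PoitouTateRestrictedShaNaturalAtOfP2monoLayerNat
import Literature.NumberTheory.GaloisRepresentations.IdeleTruncatedSLocalInjectivityTwoTC
import HarnessLib

/-!
# The END theorem of lane «PT-Ш-S-TC»: Milne ADT I Thm. 4.10 (a), restricted `Ш`-duality with its natural pairing,
# at every FINITE set of places of a TOTALLY COMPLEX number field — `forall_poitouTate_shaRestricted_tateDual_natural_at_of_isTotallyComplex`

Module `Summits/BirchSwinnertonDyer/BirchSwinnertonDyer/Theorems/EisensteinPrimesPoitouTateShaNaturalAtTC.lean`; namespace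
`Summit.BirchSwinnertonDyer.BirchSwinnertonDyer.Theorems.PoitouTateShaNaturalAtTC` (LEAD bsd-line-x1-p1 RULING #9 = the TYPE, RULING #10 = the
HOME: Summits-side, because the all-places reciprocity law behind hypothesis (R4) — door-c4 g18's `SchneiderFreeAdditiveX3PoitouTateReciprocity*` —
lives under `Summits/…/Theorems`).  Theorems only; no named fact, no `sorry`, no instance, no notation.  Helper of crux `GoodLatticeBDPValue`
(stmt-BirchSwinnertonDyer-19032): it DISCHARGES conjunct 1 of the registered stub `stub_publishedFactsMore` of line `halves` v32 BY NAME
(skeleton v33 / v33N, kit `mk_v33.py`).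

THE ASSEMBLY (every input a tree theorem; cell bsd-eis, row 4, width seats w2–w8 + LEAD, 2026-08-29):
`PoitouTateShaNaturalAtOfP2mono.forall_natural_at_of_P2mono` (-w2 g12 ADAPTER #2 = the `Ext`-road kit `ShaExtRoadKit.natural_at_of_kit'` (-w2 g11)
fed with the tree's `S`-idèle class formation `truncSeqS` (-w6 g11) and its invariant map `invS` (-w5 g10), Tate duality `hα_classBarSD` (-w8 g13 D2,
-w4 g19 Tate–Nakayama, LEAD g10 primary decomposition), the archimedean inputs (-w2 g11, LEAD g11), `Ψ(E) = Ш²` (-w7 g11–g13 (Λ1), -w2 g12 Ψ),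
the layer bridge `natLayerS` (-w5 g11 / -w6 g12), the `S`-readouts `readoutSExtB` + (R3) (-w6 g11 D4b, -w5 g11 F1/F1b) and (R4)
`PoitouTateReciprocityS.read_idelePart_eq_sum` (-w5 g11 F2 over -w6 g11 L, door-c4/c5/c6's reciprocity law)) applied to [P2-mono]
`IdeleReadout.p2mono` (Milne I Lemma 4.13 at `r = 2`, injectivity half: -w4 g20 permutation dévissage E1–E4e, -w3 g18 [P1-mono]/[P1-epi-local]/
P2-a/P2-c, -w7 g13 P2-d, -w4 g21 local leaf, LEAD g11 P2-e/f, -w8 g13 / -w3 g19 / -w7 g14 P2-b).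

HONEST FRAMING: this proves, in the kernel, the finite-`S` totally-complex case of Milne's Theorem I 4.10 (a) in the tree's formulation
(`poitouTate_shaRestricted_tateDual_natural_at`); it is ONE named input of crux 2 of the Eisenstein-primes route.  No summit statement, no case
of BSD, no main conjecture is proved by this file.  AI formalisation, established only by the kernel check.

## References
* J. S. Milne, *Arithmetic Duality Theorems*, 2nd ed. (2006), I Thm. 4.10 (a) (p. 57), its proof (p. 58), Lemma 4.13, §4 p. 65. [MilneADT2006]
* D. Harari, *Galois Cohomology and Class Field Theory*, Universitext (2020), Thm. 17.13, §17.4 (17.1), §17.5 Lemma 17.23, Prop. 17.25–17.26. [Harari2020]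
-/

noncomputable section

set_option linter.dupNamespace false
set_option autoImplicit false

open NumberField IsDedekindDomain Field CategoryTheory CategoryTheory.Abelian
open Literature.Algebra.Homology Literature.Algebra.Homology.DiscreteRep
open Literature.NumberTheory.GaloisRepresentations Literature.NumberTheory.GaloisCohomology
open scoped Classical

namespace Summit.BirchSwinnertonDyer.BirchSwinnertonDyer.Theorems.PoitouTateShaNaturalAtTC

/-- **THE END THEOREM of lane «PT-Ш-S-TC» (LEAD RULING #9 type / RULING #10 home): for every totally complex number field `K` and
every FINITE set `S` of finite places, the restricted `Ш`-duality of Milne ADT I Thm. 4.10 (a) holds at `S` with its pairing natural in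
the module** (`poitouTate_shaRestricted_tateDual_natural_at K S`): -w2 g12's `forall_natural_at_of_P2mono` applied to [P2-mono]
`IdeleReadout.p2mono`.  Discharges conjunct 1 of `stub_publishedFactsMore` of line `halves` (crux `GoodLatticeBDPValue`) BY NAME.
[cite: MilneADT2006, I Thm. 4.10 (a) (p. 57), its proof (p. 58), Lemma 4.13][cite: Harari2020, Thm. 17.13 (b), §17.4 (17.1), §17.5 Prop. 17.25–17.26] -/
theorem forall_poitouTate_shaRestricted_tateDual_natural_at_of_isTotallyComplex :
    ∀ (K : Type) [Field K] [NumberField K] [IsTotallyComplex K] (S : Set (HeightOneSpectrum (𝓞 K))),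
      S.Finite → poitouTate_shaRestricted_tateDual_natural_at K S := by
  -- ALT body (bsd-eis -w2 g12): `PoitouTateShaNaturalAtOfP2mono.forall_natural_at_of_P2mono` (p729260) INLINED, so that this file
  -- does not import `…Theorems.EisensteinPrimesPoitouTateShaNaturalAtOfP2mono` (check-farm olean unavailable at 17:00Z); same assembly:
  -- `ShaExtRoadKit.natural_at_of_P2mono_natLayerS` fed with [P2-mono] `IdeleReadout.p2mono` and the `S`-readout triple of -w5 g11.
  intro K _ _ _ S hS
  obtain ⟨S', rfl⟩ := hS.exists_finset_coe
  exact ShaExtRoadKit.natural_at_of_P2mono_natLayerS K S' (fun U _ hU _ y hy => IdeleReadout.p2mono K S' U hU y hy)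
    (fun n _ M _ _ _ _ ρ hn hur hS v =>
      haveI : Finite (DiscreteGaloisModule.TateDual K M n) := DiscreteGaloisModule.TateDual.finite K M n
      HomDual.readoutSExtB ρ n S' (PoitouTateReciprocityS.ramificationSubgroup_le_ker_tateDual ρ n S' hur hS) hn v)
    (fun n _ M _ _ _ _ ρ hn hur hS t =>
      haveI : Finite (DiscreteGaloisModule.TateDual K M n) := DiscreteGaloisModule.TateDual.finite K M n
      HomDual.exists_forall_mem_readoutSExtB_eq ρ n S' (PoitouTateReciprocityS.ramificationSubgroup_le_ker_tateDual ρ n S' hur hS)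
        hn _ (ShaExtRoadKit.inr_mem_sigma_iff K S') t)
    (fun n _ M _ _ _ _ ρ hn hur hS e y =>
      haveI : Finite (DiscreteGaloisModule.TateDual K M n) := DiscreteGaloisModule.TateDual.finite K M n
      PoitouTateReciprocityS.read_idelePart_eq_sum ρ n hn S'
        (PoitouTateReciprocityS.ramificationSubgroup_le_ker_tateDual ρ n S' hur hS) _ (ShaExtRoadKit.inl_mem_sigma K S')
        (ShaExtRoadKit.inr_mem_sigma_iff K S') e y)

end Summit.BirchSwinnertonDyer.BirchSwinnertonDyer.Theorems.PoitouTateShaNaturalAtTC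

end
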